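import Summits.QuantumFields.GaugeBoot.FrameLinkRPNegativeBeta
import Summits.QuantumFields.GaugeBoot.CubicTorusRP
import Summits.QuantumFields.GaugeBoot.TiltedBoxOddAxisGaugeGroups
import HarnessLib

/-!
# `SU(3)` link reflection positivity FAILS on the even cubic torus at every `β < 0`, `d ≥ 3` (gauge-boot, L3 negative supplement; SU(3) link reflection at `β < 0`, part 8)

HONEST FRAMING (cell `pub-gaugeboot`, page 1 of every file): the venture produces certified bounds
on lattice expectations at stated coupling, gauge group, dimension and torus size; NOT a mass gap,
NOT a continuum limit, NOT a string tension; NOT Yang–Mills-summit-bearing (barriers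
`FixedCouplingUltralocality`, `PerturbativeInvisibility`). This module is a NEGATIVE structural
result about which reflection-positivity blocks a torus bootstrap may use at negative coupling; it
bounds no expectation and no certificate of the cell sits at `β < 0`.

The cubic-torus instance of `FrameLinkRPNegativeBeta.lean`. On the even torus `(ℤ/2Q)^d`
(`Site d (2Q)`, marked translations `cubicUnit`), `Q ≥ 2`, the site frame along every axis `k`
(`isSiteFrame_cubicTorus`) gives link (mid-plane) reflection positivity of the torus Wilson measure
`wilsonMeasure ρ β` for `β ≥ 0` and every compact `G` (`cubicTorus_linkRP`), and at EVERY real `β`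
for `U(N)`, `SU(2)`, `SU(2n)` (`CubicTorusLinkRPAnyBeta.lean`, staggered central twist). For `SU(3)`:

* `thetaLink_injective` — the seven links of the theta graph are distinct as soon as
  `e_l, e_m ≠ 0`, `e_l ≠ ± e_m`, `2 e_m ≠ 0` (any periodic lattice); on `(ℤ/2Q)^d`, `Q ≥ 2`, this
  holds for any two distinct transverse directions `l ≠ m` (`thetaLink_injective_cubicTorus`);
* **`cubicTorus_linkRP_su3_neg`** — `d ≥ 3` (three distinct axes `k, l, m`), `Q ≥ 2`, EVERY
  `β < 0`: a bounded measurable observable `F` of the closed half `{1 ≤ x_k ≤ Q}` with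
  `∫ conj F(ΘU) · F(U) dμ_β(U) < 0`, `μ_β = wilsonMeasure (fundamentalRep (Fin 3)) β` the `SU(3)`
  Wilson measure of `ConstructiveQFTWave0`, `Θ = configMidReflect (cubicUnit …) k (cubicAxisReflect …)`
  the reflection in `x_k = ½`;
* **`not_cubicTorus_linkRP_su3`** — so the statement of `cubicTorus_linkRP_suN` (`N = 3`) with
  `0 ≤ β` replaced by any `β < 0` is FALSE: the link family of an `SU(3)` torus bootstrap is
  genuinely confined to `β ≥ 0` (in contrast with `SU(2)`), and `β = 0` is the exact threshold
  (`d ≥ 3`; in `d = 2` there is no transverse pair of directions and nothing is claimed).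
* `cubicTorus_linkRP_detOne_neg` — the same for any compact second countable `G` and continuous
  `ρ : G → M₃(ℂ)` with `det ρ ≡ 1`, scalar commutant, `ρ ≢ 1` (e.g. `SO(3)`).

References: K. Osterwalder, E. Seiler, Ann. Phys. 110 (1978) 440, §2; E. Seiler, LNP 159 (1982)
Ch. 2; M. Creutz, Quarks, Gluons and Lattices (1983) Ch. 8; V. Kazakov, Z. Zheng,
arXiv:2203.11360 §3.1 (link reflections of the torus bootstrap).
-/

noncomputable section

open MeasureTheory Complex
open scoped ComplexOrder ComplexConjugate
open Literature.MathematicalPhysics.QuantumFieldTheory (Site GaugeConfig wilsonMeasure)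
open Literature.MathematicalPhysics.QuantumLattice (fundamentalRep continuous_fundamentalRep)

namespace Summit.QuantumFields.GaugeBoot

namespace TiltedRP

open Baryon

/-! ## Distinctness of the seven theta links -/

section Injective

variable {A : Type*} [AddCommGroup A] {d : ℕ}

/-- **The seven theta links are distinct** when `e_l, e_m ≠ 0`, `e_l ≠ e_m`, `e_l + e_m ≠ 0`,
`e_m + e_m ≠ 0` and `l ≠ m` (any periodic lattice). [folklore] -/
theorem thetaLink_injective (e : Fin d → A) (x : A) {l m : Fin d} (hlm : l ≠ m) (hl0 : e l ≠ 0)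
    (hm0 : e m ≠ 0) (hne : e l ≠ e m) (hsum : e l + e m ≠ 0) (h2 : e m + e m ≠ 0) :
    Function.Injective (thetaLink e x l m) := by
  have hne' : e m ≠ e l := fun h => hne h.symm
  have hneg : e l ≠ -e m := fun h => hsum (by rw [h, neg_add_cancel])
  have hneg' : -e m ≠ e l := fun h => hneg h.symm
  have hneg2 : e m ≠ -e m := fun h => h2 (by nth_rw 1 [h]; rw [neg_add_cancel])
  have hneg2' : -e m ≠ e m := fun h => hneg2 h.symm
  have hml : -e m + e l ≠ 0 := fun h => hne' (neg_add_eq_zero.1 h)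
  intro r s hrs
  fin_cases r <;> fin_cases s <;>
    simp [thetaLink, sub_eq_add_neg, add_assoc, hlm, hlm.symm, hl0, hm0, hne, hne',
      hneg, hneg', hneg2, hneg2', hml] at hrs ⊢

/-- On the even cubic torus `(ℤ/2Q)^d`, `Q ≥ 2`, the theta links of two distinct directions
`l ≠ m` at any site are distinct. [folklore] -/
theorem thetaLink_injective_cubicTorus {Q : ℕ} (hQ : 2 ≤ Q) (x : Site d (2 * Q)) {l m : Fin d}
    (hlm : l ≠ m) : Function.Injective (thetaLink (cubicUnit d (2 * Q)) x l m) := by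
  haveI : Fact (1 < 2 * Q) := ⟨by omega⟩
  have h1 : (1 : ZMod (2 * Q)) ≠ 0 := one_ne_zero
  have h2 : (1 : ZMod (2 * Q)) + 1 ≠ 0 := by
    rw [show (1 : ZMod (2 * Q)) + 1 = ((2 : ℕ) : ZMod (2 * Q)) by norm_num,
      Ne, ZMod.natCast_eq_zero_iff]
    intro h
    have := Nat.le_of_dvd (by norm_num) h
    omega
  have hval : ∀ n : Fin d, ∀ y : Site d (2 * Q), y = 0 → y n = 0 := fun n y hy => by rw [hy]; rfl
  refine thetaLink_injective _ x hlm ?_ ?_ ?_ ?_ ?_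
  · intro h; exact h1 (by simpa [cubicUnit_apply] using hval l _ h)
  · intro h; exact h1 (by simpa [cubicUnit_apply] using hval m _ h)
  · intro h
    have := congrFun h l
    simp [cubicUnit_apply, hlm] at this
  · intro h; exact h1 (by simpa [cubicUnit_apply, hlm, hlm.symm] using hval l _ h)
  · intro h; exact h2 (by simpa [cubicUnit_apply] using hval m _ h)

end Injective

/-! ## The even cubic torus -/

section Torus

variable {d Q : ℕ} [NeZero Q]

omit [NeZero Q] in
/-- The site `e_k` of the torus has `k`-coordinate `1`. [folklore] -/
theorem val_cubicAxisCoord_cubicUnit (hQ : 2 ≤ Q) (k : Fin d) :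
    (cubicAxisCoord d (2 * Q) k (cubicUnit d (2 * Q) k)).val = 1 := by
  haveI : Fact (1 < 2 * Q) := ⟨by omega⟩
  rw [cubicAxisCoord_apply, cubicUnit_apply, if_pos rfl, ZMod.val_one]

variable {G : Type} [Group G] [TopologicalSpace G] [IsTopologicalGroup G] [CompactSpace G]
  [MeasurableSpace G] [BorelSpace G] [SecondCountableTopology G]

/-- **Link RP fails on the even torus at every `β < 0` for three-dimensional representations of
determinant one.** `(ℤ/2Q)^d`, `Q ≥ 2`, three distinct axes `k, l, m` (so `d ≥ 3`), `G` compact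
second countable, `ρ : G → M₃(ℂ)` continuous with `det ρ ≡ 1`, scalar commutant, `ρ ≢ 1`, and any
`β < 0`: a bounded measurable observable of `{1 ≤ x_k ≤ Q}` with `∫ conj F(ΘU) · F(U) dμ_β < 0`,
`μ_β = wilsonMeasure ρ β`, `Θ` the reflection in `x_k = ½`. -/
theorem cubicTorus_linkRP_detOne_neg (ρ : G →* Matrix (Fin 3) (Fin 3) ℂ) (hQ : 2 ≤ Q) {k l m : Fin d}
    (hl : l ≠ k) (hm : m ≠ k) (hlm : l ≠ m) (hρ : Continuous ρ)
    (hirr : TwistedSlab.HasScalarCommutant ρ) (hρ1 : ∃ g, ρ g ≠ 1) (hdet : ∀ g, (ρ g).det = 1)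
    {β : ℝ} (hβ : β < 0) :
    ∃ F : GaugeConfig d (2 * Q) G → ℂ, Measurable F ∧ (∃ C : ℝ, ∀ U, ‖F U‖ ≤ C) ∧
      IsMidObservable (cubicUnit d (2 * Q)) Q (cubicAxisCoord d (2 * Q) k) F ∧
      ∫ U, conj (F (configMidReflect (cubicUnit d (2 * Q)) k (cubicAxisReflect d (2 * Q) k) U)) *
        F U ∂(wilsonMeasure (d := d) (L := 2 * Q) ρ β) < 0 := by
  have hF := isSiteFrame_cubicTorus d hQ k
  have hx₁ := val_cubicAxisCoord_cubicUnit hQ k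
  refine ⟨thetaWitness (cubicUnit d (2 * Q)) k Q (cubicAxisCoord d (2 * Q) k) ρ β
      (cubicUnit d (2 * Q) k) l m,
    (continuous_thetaWitness (cubicUnit d (2 * Q)) k Q (cubicAxisCoord d (2 * Q) k) ρ hρ β _ l m).measurable,
    exists_norm_thetaWitness_le (cubicUnit d (2 * Q)) k Q (cubicAxisCoord d (2 * Q) k) ρ hρ β _ l m,
    hF.isMidObservable_thetaWitness ρ hx₁ hl hm β, ?_⟩
  rw [← gibbs_cubicUnit_eq_wilsonMeasure ρ hρ β]
  exact hF.linkRP_integral_conj_mul_neg_of_neg ρ hρ hirr hρ1 hdet hx₁ hl hm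
    (thetaLink_injective_cubicTorus hQ _ hlm) hβ

/-- **`SU(3)` LINK REFLECTION POSITIVITY FAILS ON THE EVEN TORUS AT EVERY `β < 0` (`d ≥ 3`).**
On `(ℤ/2Q)^d`, `Q ≥ 2`, with three distinct axes `k, l, m`, for `SU(3)` lattice Yang–Mills in the
fundamental representation (Wilson action, `wilsonMeasure (fundamentalRep (Fin 3)) β`) and any
`β < 0`, there is a bounded measurable observable `F` of the closed half `{1 ≤ x_k ≤ Q}` with
`∫ conj F(ΘU) · F(U) dμ_β(U) < 0`, `Θ` the reflection in the hyperplane `x_k = ½`. The witness is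
the baryonic theta observable of the layer `x_k = 1` times `exp(-β A)`. -/
theorem cubicTorus_linkRP_su3_neg (hQ : 2 ≤ Q) {k l m : Fin d} (hl : l ≠ k) (hm : m ≠ k)
    (hlm : l ≠ m) {β : ℝ} (hβ : β < 0) :
    ∃ F : GaugeConfig d (2 * Q) (Matrix.specialUnitaryGroup (Fin 3) ℂ) → ℂ, Measurable F ∧
      (∃ C : ℝ, ∀ U, ‖F U‖ ≤ C) ∧
      IsMidObservable (cubicUnit d (2 * Q)) Q (cubicAxisCoord d (2 * Q) k) F ∧
      ∫ U, conj (F (configMidReflect (cubicUnit d (2 * Q)) k (cubicAxisReflect d (2 * Q) k) U)) *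
        F U ∂(wilsonMeasure (d := d) (L := 2 * Q) (fundamentalRep (Fin 3)) β) < 0 := by
  haveI : SecondCountableTopology (Matrix (Fin 3) (Fin 3) ℂ) :=
    inferInstanceAs (SecondCountableTopology (Fin 3 → Fin 3 → ℂ))
  haveI : SecondCountableTopology (Matrix.specialUnitaryGroup (Fin 3) ℂ) :=
    Topology.IsEmbedding.subtypeVal.secondCountableTopology
  exact cubicTorus_linkRP_detOne_neg (fundamentalRep (Fin 3)) hQ hl hm hlm
    (continuous_fundamentalRep (Fin 3)) hasScalarCommutant_fundamentalRep
    (exists_fundamentalRep_ne_one (by norm_num))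
    (fun g => (Matrix.mem_specialUnitaryGroup_iff.1 g.2).2) hβ

/-- **Corollary: the link RP statement of `cubicTorus_linkRP_suN` for `SU(3)` is FALSE at every
`β < 0`** (`(ℤ/2Q)^d`, `Q ≥ 2`, three distinct axes `k, l, m`): link-hyperplane reflection
positivity of `SU(3)` lattice Yang–Mills on the even torus holds exactly for `β ≥ 0`. -/
theorem not_cubicTorus_linkRP_su3 (hQ : 2 ≤ Q) {k l m : Fin d} (hl : l ≠ k) (hm : m ≠ k)
    (hlm : l ≠ m) {β : ℝ} (hβ : β < 0) :
    ¬ ∀ F : GaugeConfig d (2 * Q) (Matrix.specialUnitaryGroup (Fin 3) ℂ) → ℂ, Measurable F →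
        (∃ C : ℝ, ∀ U, ‖F U‖ ≤ C) →
        IsMidObservable (cubicUnit d (2 * Q)) Q (cubicAxisCoord d (2 * Q) k) F →
        0 ≤ ∫ U, conj (F (configMidReflect (cubicUnit d (2 * Q)) k (cubicAxisReflect d (2 * Q) k) U)) *
          F U ∂(wilsonMeasure (d := d) (L := 2 * Q) (fundamentalRep (Fin 3)) β) := by
  intro hall
  obtain ⟨F, hFm, hFb, hFo, hneg⟩ := cubicTorus_linkRP_su3_neg hQ hl hm hlm hβ
  exact absurd (hall F hFm hFb hFo) (not_le_of_gt hneg)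

/-- **The threshold is exactly `β = 0`**: for `SU(3)` on the even torus `(ℤ/2Q)^d`, `Q ≥ 2`, with
three distinct axes available, closed-half link reflection positivity along `k` holds for all
bounded measurable half observables if and only if `0 ≤ β`. -/
theorem cubicTorus_linkRP_su3_iff (hQ : 2 ≤ Q) {k l m : Fin d} (hl : l ≠ k) (hm : m ≠ k)
    (hlm : l ≠ m) (β : ℝ) :
    (∀ F : GaugeConfig d (2 * Q) (Matrix.specialUnitaryGroup (Fin 3) ℂ) → ℂ, Measurable F →
        (∃ C : ℝ, ∀ U, ‖F U‖ ≤ C) →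
        IsMidObservable (cubicUnit d (2 * Q)) Q (cubicAxisCoord d (2 * Q) k) F →
        0 ≤ ∫ U, conj (F (configMidReflect (cubicUnit d (2 * Q)) k (cubicAxisReflect d (2 * Q) k) U)) *
          F U ∂(wilsonMeasure (d := d) (L := 2 * Q) (fundamentalRep (Fin 3)) β)) ↔ 0 ≤ β := by
  constructor
  · intro hall
    by_contra hβ
    exact not_cubicTorus_linkRP_su3 hQ hl hm hlm (not_le.1 hβ) hall
  · intro hβ F hFm hFb hFo
    exact cubicTorus_linkRP_suN hQ k hβ F hFm hFb hFo

end Torus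

end TiltedRP

end Summit.QuantumFields.GaugeBoot

end
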